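/-
Copyright (c) 2026 the pub-hodgecm-mathlib formalisation cell (harness21).  Prover seat hodgecm-mathlib-F0P2-p11 (g2) (L1; LEAD F0P6-plan (g14) «(o1) KIND 1», memo
`CENSUS-K1-DealTable` ADDENDUM 2 route (c‴)), Track B «K2-LIT» ∕ hLiu418 #184♮, ROAD Φ, G5-b: THE CORNER COORDINATE OF A LEVI-CONJUGATED UNIPOTENT —
`X(Λg⁻¹ u Λg) = g⁻¹ · X(u) · g♯` and, at `n = 2` on the corner line, `X(…)₁₁ = (g⁻¹)₁₁ · σ((g⁻¹)₁₁) · c`.  THEOREMS ONLY.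
-/
import Summits.HodgeConjecture.HodgeConjecture.Theorems.K2LiuSiegelLeviConjUnipDeltaChar      -- ★ `deltaBlock_mul_toBlocks₁₂_conj`
import Summits.HodgeConjecture.HodgeConjecture.Theorems.K2LiuSiegelRationalLeviDecomposition  -- ★ `frame_levi_apply`, `deltaBlock_levi_apply`, `isSiegelDelta_levi_apply`
import Summits.HodgeConjecture.HodgeConjecture.Theorems.K2LiuUnipDeltaCornerCoordinates      -- ★ `exists_gramRA_eq_diagonal` (n = 2)
import HarnessLib

/-!
# Crux `HLiu418`, KIND 1, (K1b-W) route (c‴): the corner coordinate after Levi conjugation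

Cell `hodgecm-mathlib`, crux item hLiu418 = `stmt-HodgeConjecture-24832` (helper lane, count-neutral); squad K2 ∕ K2Liu, LEAD F0P6-plan (g14); prover F0P2-p11 (g2).
THEOREMS ONLY (no `def`, no `instance`, no notation, no named-fact hypothesis, no `sorry`).

★ p862907 `apply_reflStd_unip_levi_upper` reduces the translated K1-b♮ integrand to `f (w₀ · u' · y)` for ANY unipotent `u'` with `X(u')₁₁ = X(Λb⁻¹ u Λb)₁₁`.  THIS FILE computes
that coordinate: §1 (any `n`, Levi chart `Λ ∕ hΛ`) **`toBlocks₁₂_levi_conj`** — `X(Λg⁻¹ · u · Λg) = g⁻¹ · (X(u) · g♯)`, `g♯ = T⁻¹(ḡ⁻¹)ᵀT` (★ `deltaBlock_mul_toBlocks₁₂_conj` with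
★ `deltaBlock_levi_apply`, ★ `frame_levi_apply`); §2 (`n = 2`, `X(u) = single 1 1 c` — the corner line of ★ p861153) **`toBlocks₁₂_levi_conj_corner`** —
`X(Λg⁻¹ u Λg)₁₁ = (g⁻¹)₁₁ · σ((g⁻¹)₁₁) · c` (the Gram matrix is diagonal with unit entries ★ `exists_gramRA_eq_diagonal`).  So the rescaled corner line is
`n₂ (N((g⁻¹)₁₁) · t)` with the NORM factor `x σ(x)` (σ-invariant, hence `∈ 𝔸_{L⁺} ⊗ 1`).
HONEST LABEL.  Count-neutral helper; `HC_CM` is proved only modulo the 7 printed citations (2 remaining named inputs: hLiu418 = `stmt-HodgeConjecture-24832`,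
h413 = `stmt-HodgeConjecture-24833`) until rung 0 closes.

## References
* [HarrisKudlaSweet1996] M. Harris, S. Kudla, W. Sweet, J. AMS 9 (1996), §1 (1.11)–(1.12).
* [MoeglinWaldspurger1995] C. Mœglin, J.-L. Waldspurger, CUP (1995), I.2.1, II.1.7.
* [KudlaRallis1994] S. Kudla, S. Rallis, Ann. of Math. 140 (1994), §2 (2.10)–(2.12).
-/

set_option autoImplicit false
set_option linter.dupNamespace false -- the mandated namespace repeats `HodgeConjecture.HodgeConjecture`

noncomputable section

open scoped Matrix
open NumberField IsDedekindDomain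
open Literature.NumberTheory.Automorphic Literature.NumberTheory.Automorphic.UnitaryGroup Literature.NumberTheory.GaloisRepresentations
open Literature.NumberTheory.GelbartRogawski1991 Literature.NumberTheory.GelbartRogawski1991.GRConstruction
open Literature.NumberTheory.GelbartRogawski1991.AdaptedBlocks
open Literature.NumberTheory.K2Lit.SiegelDoubled
open UnitaryDualPair

namespace Summit.HodgeConjecture.HodgeConjecture.Cruxes.HLiu418.K2LiuLeviConjCornerCoordinate

open K2LiuSiegelUnipotentFourierDefs K2LiuSiegelLeviConjUnipDeltaChar K2LiuSiegelRationalLeviDecomposition K2LiuUnipDeltaCornerCoordinates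

variable (L : Type) [Field L] [NumberField L] [IsCMField L]

/-! ## §1 Any rank: `X(Λg⁻¹ · u · Λg) = g⁻¹ · X(u) · g♯` -/

section Any

variable {N M n : ℕ} (e : Fin N × Fin M ≃ Fin n)
  (dV : Fin N → L) (hdV : ∀ i, IsCMField.complexConj L (dV i) = dV i)
  (dW : Fin M → L) (hdW : ∀ i, IsCMField.complexConj L (dW i) = dW i)
  (Λ : GL (Fin n) (AdeleRing (𝓞 L) L) →* HA L e dV hdV dW hdW)
  (hΛ : ∀ g : GL (Fin n) (AdeleRing (𝓞 L) L), blk L e dV hdV dW hdW (Λ g) =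
    cayR (AdeleRing (𝓞 L) L) (Fin n) * Matrix.fromBlocks (g : Matrix (Fin n) (Fin n) (AdeleRing (𝓞 L) L)) 0 0
      (((gramR L e dV hdV dW hdW).map ((algebraMap L (AdeleRing (𝓞 L) L)).comp (algebraMap (Fp L) L)))⁻¹ *
        (((g⁻¹ : GL (Fin n) (AdeleRing (𝓞 L) L)) : Matrix (Fin n) (Fin n) (AdeleRing (𝓞 L) L)).map
          (conjAdele (Fp L) L (IsCMField.complexConj L)))ᵀ *
        (gramR L e dV hdV dW hdW).map ((algebraMap L (AdeleRing (𝓞 L) L)).comp (algebraMap (Fp L) L))) *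
      cayRinv (AdeleRing (𝓞 L) L) (Fin n))

include hΛ in
/-- **`X(Λg⁻¹ · u · Λg) = g⁻¹ · (X(u) · g♯)`** for `u ∈ N_Δ(𝔸)` and `g ∈ GL_n(𝔸_L)`, with `g♯ = T⁻¹ (ḡ⁻¹)ᵀ T` the co-block of the Levi chart
(★ `deltaBlock_mul_toBlocks₁₂_conj`; `deltaBlock (Λ g) = g`, frame `(2,2)`-block `= g♯`). [cite: HarrisKudlaSweet1996, §1 (1.11)–(1.12)] [cite: MoeglinWaldspurger1995, I.2.1] -/
theorem toBlocks₁₂_levi_conj (g : GL (Fin n) (AdeleRing (𝓞 L) L)) {u : HA L e dV hdV dW hdW} (hu : u ∈ unipDelta L e dV hdV dW hdW) :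
    (blk L e dV hdV dW hdW ((Λ g)⁻¹ * u * Λ g)).toBlocks₁₂ =
      ((g⁻¹ : GL (Fin n) (AdeleRing (𝓞 L) L)) : Matrix (Fin n) (Fin n) (AdeleRing (𝓞 L) L)) *
        ((blk L e dV hdV dW hdW u).toBlocks₁₂ *
          (((gramR L e dV hdV dW hdW).map ((algebraMap L (AdeleRing (𝓞 L) L)).comp (algebraMap (Fp L) L)))⁻¹ *
            (((g⁻¹ : GL (Fin n) (AdeleRing (𝓞 L) L)) : Matrix (Fin n) (Fin n) (AdeleRing (𝓞 L) L)).map (conjAdele (Fp L) L (IsCMField.complexConj L)))ᵀ *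
            (gramR L e dV hdV dW hdW).map ((algebraMap L (AdeleRing (𝓞 L) L)).comp (algebraMap (Fp L) L)))) := by
  have h := deltaBlock_mul_toBlocks₁₂_conj L e dV hdV dW hdW (isSiegelDelta_levi_apply L e dV hdV dW hdW Λ hΛ g) hu
  rw [deltaBlock_levi_apply L e dV hdV dW hdW Λ hΛ g, frame_levi_apply L e dV hdV dW hdW Λ hΛ g, Matrix.toBlocks_fromBlocks₂₂] at h
  rw [← Units.inv_mul_cancel_left g ((blk L e dV hdV dW hdW ((Λ g)⁻¹ * u * Λ g)).toBlocks₁₂), Matrix.coe_units_inv, ← Matrix.coe_units_inv, h]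

end Any

/-! ## §2 `n = 2`: the corner entry on the corner line -/

section Two

variable {N M : ℕ} (e : Fin N × Fin M ≃ Fin 2)
  (dV : Fin N → L) (hdV : ∀ i, IsCMField.complexConj L (dV i) = dV i)
  (dW : Fin M → L) (hdW : ∀ i, IsCMField.complexConj L (dW i) = dW i)
  (Λ : GL (Fin 2) (AdeleRing (𝓞 L) L) →* HA L e dV hdV dW hdW)
  (hΛ : ∀ g : GL (Fin 2) (AdeleRing (𝓞 L) L), blk L e dV hdV dW hdW (Λ g) =
    cayR (AdeleRing (𝓞 L) L) (Fin 2) * Matrix.fromBlocks (g : Matrix (Fin 2) (Fin 2) (AdeleRing (𝓞 L) L)) 0 0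
      (((gramR L e dV hdV dW hdW).map ((algebraMap L (AdeleRing (𝓞 L) L)).comp (algebraMap (Fp L) L)))⁻¹ *
        (((g⁻¹ : GL (Fin 2) (AdeleRing (𝓞 L) L)) : Matrix (Fin 2) (Fin 2) (AdeleRing (𝓞 L) L)).map
          (conjAdele (Fp L) L (IsCMField.complexConj L)))ᵀ *
        (gramR L e dV hdV dW hdW).map ((algebraMap L (AdeleRing (𝓞 L) L)).comp (algebraMap (Fp L) L))) *
      cayRinv (AdeleRing (𝓞 L) L) (Fin 2))

include hΛ in
/-- **THE CORNER ENTRY AFTER LEVI CONJUGATION**: for `u ∈ N_Δ(𝔸)` on the corner line, `X(u) = single 1 1 c`, and `g ∈ GL₂(𝔸_L)`: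
`X(Λg⁻¹ u Λg)₁₁ = (g⁻¹)₁₁ · σ((g⁻¹)₁₁) · c` — a NORM rescaling of the corner coordinate (§1 and `(g♯)₁₁ = σ((g⁻¹)₁₁)` since `T` is diagonal with unit entries,
★ `exists_gramRA_eq_diagonal`). [cite: KudlaRallis1994, §2 (2.10)–(2.12)] [cite: HarrisKudlaSweet1996, §1 (1.11)–(1.12)] -/
theorem toBlocks₁₂_levi_conj_corner (hdV0 : ∀ i, dV i ≠ 0) (hdW0 : ∀ i, dW i ≠ 0) (g : GL (Fin 2) (AdeleRing (𝓞 L) L))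
    {u : HA L e dV hdV dW hdW} (hu : u ∈ unipDelta L e dV hdV dW hdW) {c : AdeleRing (𝓞 L) L}
    (hX : (blk L e dV hdV dW hdW u).toBlocks₁₂ = Matrix.single (1 : Fin 2) (1 : Fin 2) c) :
    (blk L e dV hdV dW hdW ((Λ g)⁻¹ * u * Λ g)).toBlocks₁₂ 1 1 =
      ((g⁻¹ : GL (Fin 2) (AdeleRing (𝓞 L) L)) : Matrix (Fin 2) (Fin 2) (AdeleRing (𝓞 L) L)) 1 1 *
        conjAdele (Fp L) L (IsCMField.complexConj L) (((g⁻¹ : GL (Fin 2) (AdeleRing (𝓞 L) L)) : Matrix (Fin 2) (Fin 2) (AdeleRing (𝓞 L) L)) 1 1) * c := by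
  obtain ⟨t, ht0, hT⟩ := exists_gramRA_eq_diagonal L e dV hdV dW hdW hdV0 hdW0
  set T : Matrix (Fin 2) (Fin 2) (AdeleRing (𝓞 L) L) := (gramR L e dV hdV dW hdW).map ((algebraMap L (AdeleRing (𝓞 L) L)).comp (algebraMap (Fp L) L)) with hTdef
  set Gi : Matrix (Fin 2) (Fin 2) (AdeleRing (𝓞 L) L) := ((g⁻¹ : GL (Fin 2) (AdeleRing (𝓞 L) L)) : Matrix (Fin 2) (Fin 2) (AdeleRing (𝓞 L) L)) with hGi
  set W : Matrix (Fin 2) (Fin 2) (AdeleRing (𝓞 L) L) := T⁻¹ * (Gi.map (conjAdele (Fp L) L (IsCMField.complexConj L)))ᵀ * T with hW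
  -- `T = diag(t₀, t₁)` with unit entries
  have hTdet : IsUnit T.det := by
    rw [hT, Matrix.det_diagonal, Fin.prod_univ_two]
    exact ((IsUnit.mk0 _ (ht0 0)).map _).mul ((IsUnit.mk0 _ (ht0 1)).map _)
  have hT01 : T 0 1 = 0 := by rw [hT, Matrix.diagonal_apply_ne _ (by decide)]
  have hTi10 : T⁻¹ 1 0 = 0 := by rw [hT, Matrix.inv_diagonal, Matrix.diagonal_apply_ne _ (by decide)]
  have hinv11 : T⁻¹ 1 1 * T 1 1 = 1 := by
    have h := congrFun (congrFun (Matrix.nonsing_inv_mul T hTdet) 1) 1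
    rwa [Matrix.mul_apply, Fin.sum_univ_two, hT01, mul_zero, zero_add, Matrix.one_apply_eq] at h
  -- the `(1,1)` entry of the co-block `W = g♯`
  have hW11 : W 1 1 = conjAdele (Fp L) L (IsCMField.complexConj L) (Gi 1 1) := by
    rw [hW, Matrix.mul_apply, Fin.sum_univ_two, hT01, mul_zero, zero_add, Matrix.mul_apply, Fin.sum_univ_two, hTi10, zero_mul, zero_add,
      Matrix.transpose_apply, Matrix.map_apply, mul_right_comm, hinv11, one_mul]
  -- the `(1,1)` entry of `g⁻¹ · (single 1 1 c · W)`
  rw [toBlocks₁₂_levi_conj L e dV hdV dW hdW Λ hΛ g hu, hX]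
  show (Gi * (Matrix.single (1 : Fin 2) (1 : Fin 2) c * W)) 1 1 = Gi 1 1 * conjAdele (Fp L) L (IsCMField.complexConj L) (Gi 1 1) * c
  have hS01 : (Matrix.single (1 : Fin 2) (1 : Fin 2) c * W) 0 1 = 0 := by
    rw [Matrix.mul_apply, Fin.sum_univ_two]
    simp
  have hS11 : (Matrix.single (1 : Fin 2) (1 : Fin 2) c * W) 1 1 = c * W 1 1 := by
    rw [Matrix.mul_apply, Fin.sum_univ_two]
    simp
  rw [Matrix.mul_apply, Fin.sum_univ_two, hS01, hS11, mul_zero, zero_add, hW11]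
  ring

end Two

end Summit.HodgeConjecture.HodgeConjecture.Cruxes.HLiu418.K2LiuLeviConjCornerCoordinate

end
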